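import Literature.MathematicalPhysics.QuantumFieldTheory.Balaban1983to89.B9Conv348GaugeOrbitAtLettersY
import Literature.MathematicalPhysics.QuantumFieldTheory.Balaban1983to89.B9Thm311PureGaugeClassAtLettersR

/-!
# `Balaban1983to89.B9Thm39PureGaugeClassAtLettersR` — rows 15–16 of the N06 knit ([B9] Theorem 3.9 ⇒ Theorem 3.2) ARE THEOREMS ON THE CLASS OF
# PURE GAUGES at def-Y's letters of record, and rows 15 ∧ 16 ∧ 17 hold there JOINTLY with ZERO analytic hypotheses (one class, one letters family,
# one expansion record) — the non-vacuous joint inhabitant of the rows' member-local binders (STANDING A6 RULE ∕ WATCH-JSAT-N06)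

T. Bałaban, *Propagators for lattice gauge theories in a background field*, Commun. Math. Phys. **99** (1985) 389–434
[`Balaban1985BackgroundPropagators`, "B9"]; [4] = T. Bałaban, *Propagators and renormalization transformations for lattice gauge theories. II*,
Commun. Math. Phys. **96** (1984) 223–250 [`Balaban1984PropagatorsII`].

statement-level skeleton of published theorems with citation tags; proofs where landed; nothing here is a claim about the Yang–Mills mass gap

THE PRINTED LOCI (verbatim).  p. 398, Theorem 3.2 (3.48): *«|(Q′(U)G′²(U)Q′\*(U))⁻¹(y, y′)| ≦ B₀(Lʲη)⁻⁴(L^{j′}η)^{−d}e^{−δ₀d(y,y′)}»*; p. 413, Theorem 3.9: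
*«This theorem implies Theorem 3.2»*; p. 407, Cor. 3.5: *«for U = 1 these theorems are proved in [4]»*; p. 396, (3.33)–(3.34) (gauge covariance);
p. 416, Theorem 3.11: *«operators Δ′_a(U), G′(U), (Q′(U)G′²(U)Q′\*(U))⁻¹, Δ_a(U), G(U) are positive for U in the domain (3.35)»*.

WHY THIS FILE (cell context; director-ym's STANDING A6 RULE — every junction∕knit lemma whose hypotheses are member-local binders ships a named
inhabitant — and referee ref-A's WATCH-JSAT-N06).  The CASCADE-R faces of rows 15–16 (`B9Thm39Thm311AtLettersR.t39_hksum_of_pins_opsYOfLettersR`, and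
the one-display faces of `B9Thm39OneCubeReadingAtLettersY`) carry ONE analytic display — Theorem 3.2's (3.48) read on the inverse, `Conv348Blk` at the
one-cube letters — which the tree now PROVES on the class of pure gauges `R₁ := pureGaugeFamY` (n06-j `B9Conv348GaugeOrbitAtLettersY.
conv348_oneCubeYF_pureGauge_recordV4`: [4] Prop. 2.3 of record at `U = 1`, transported along the orbit by (3.33)).  THIS FILE assembles: §1 the
CASCADE-R × FAITHFUL one-cube letters `oneCubeOps39YFR`, the orbit stability of their display `conv348_oneCubeYFR_gaugeY`, and their face ★ `t39_hksum_oneCube_opsYOfLetters_FR` (rows 15 ∧ 16 at generic `(R₁, R₂)` from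
ONE display on the faithful block map); §2 on `R₁ := pureGaugeFamY` at `lettersYOfRecordV4`: ★ `h348_pureGaugeFamY_F` (the display DISCHARGED),
★★ `t39_hksum_pureGaugeR` (rows 15 ∧ 16 from the pins `hβI`, `hEK39` and the faithfulness data `hβ1`, `hlev` ALONE), the pinned expansion letters
`pinEK39F` (`EK39_pinEK39F`, `rfl`), ★★★ `t39_hksum_pureGaugeR_pinned` (rows 15 ∧ 16 with the pin built in: the only hypotheses left are the bond map's
faithfulness and two numerals' signs), ★★★ `thm32_pureGaugeR_pinned` (Theorem 3.2 AS TYPED on the class), and §3 ★★★ `rows151617_pureGaugeR_pinned`: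
with g13's `t311_pureGaugeR_pinned`, rows 15 ∧ 16 ∧ 17 of the certificate hold JOINTLY on ONE class (`pureGaugeFamY`, non-empty at every member:
`one_mem_pureGaugeFamY`), ONE letters family (`lettersYOfRecordV4 N θ M⋆ 𝔯`), ONE expansion record (`pinPosDef311 θ M⋆ 𝔯 (pinEK39F …)`); §4 the A6
`∃`-statement `binders_t39FR_inhabited`.

HONEST SCOPE.  The class is the GAUGE ORBIT OF THE TRIVIAL BACKGROUND (flat), a sub-class of every (3.35); rows 15–16 at print's class need
Theorem 3.2 proper and row 17 needs Theorem 3.3 ∕ [4]'s uniform coercivity — displayed, not in the tree at def-Y's letters; the block map is n06-i's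
FAITHFUL one (`blk39F`), the bond map `bI` and its faithfulness (`hβI`, `hβ1`, `hlev`) stay binders (n06-i's `B9BetaRangeKLevelV1` supplies them at the
record; not re-derived here); [4] enters only through T8's DISCHARGED census; NOT a node discharge, NOT summit progress; count-neutral; one finite 𝕋⁴
programme — nothing continuum, nothing about the mass gap.  Cell `pub-ymgap` (HUMAN RULING D-0062), Track A node N06 [B9], seat
`pub-ymgap-dag-n06-j` (harness re-seat gen 15), 2026-08-27.  No `sorry`, no `axiom`, no `instance`, no `notation`; two `def`s (`oneCubeOps39YFR`,
`pinEK39F`).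
-/

noncomputable section

namespace Literature.MathematicalPhysics.QuantumFieldTheory.Balaban1983to89.B9Thm39PureGaugeClassAtLettersR

open Literature.MathematicalPhysics.QuantumFieldTheory.Balaban1983to89
open Finset B6RandomWalk B9Thm39Whole B9Thm39WholeBlk B9Thm39WholeBlkVia B9Thm39WholeBlkViaDatum B9Thm39ReadingCoords B9Thm39ReadingAtLetters
  B9Thm39ReadingFaithful B9Thm39Thm311AtLettersR B9Thm39OneCubeReadingAtLettersY B9Conv348GaugeOrbitAtLettersY B9Thm311Whole
  B9Thm311PosAtRecordV4 B9Thm311PureGaugeClassAtLettersR Node00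
open B6KLevelCensusIndexV1 B6Geom246MultiLevelBox B6Geom246MultiLevelTorus B6Ineq2142KLevelV1 B6GlobalChartV1 B9PinMembersKLevelV1
  B9PinCarriersKLevelV1 B9PinGeometryKLevelV1 B7Prop2SpecialUnitary B9Ineq349SiteFromConv348 B9BackgroundsKLevelV1R B9GeoLemma21KLevelV1

/-! ## §1 The CASCADE-R × faithful one-cube letters and their face at generic `(R₁, R₂)` -/

section FaceFR

open scoped Matrix.Norms.L2Operator

variable {N : ℕ} (θ : Stage3Params) (Mstar : ℕ) (𝔏 : LettersY N θ Mstar) (𝔈 : ExpsY N θ Mstar)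
variable [∀ x : MemberY θ.d₆ θ.ℓ₆ θ.hd' θ.hL' θ.b₀ θ.b₁ Mstar, Fintype (geo9Y x).Site]
  [∀ x : MemberY θ.d₆ θ.ℓ₆ θ.hd' θ.hL' θ.b₀ θ.b₁ Mstar, DecidableEq (geo9Y x).Site]
variable (R₁ R₂ : RegFamY θ.d₆ θ.ℓ₆ θ.hd' θ.hL' θ.b₀ θ.b₁ Mstar (Matrix (Fin N) (Fin N) ℂ))
variable (bI : ∀ x : MemberY θ.d₆ θ.ℓ₆ θ.hd' θ.hL' θ.b₀ θ.b₁ Mstar, FBondY x.toKIdx → IBondY x.toKIdx)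

omit [∀ x : MemberY θ.d₆ θ.ℓ₆ θ.hd' θ.hL' θ.b₀ θ.b₁ Mstar, DecidableEq (geo9Y x).Site] in
/-- **THE ONE-CUBE LETTERS, CLASS-PARAMETRIC TYPING, FAITHFUL BLOCK MAP**: `oneCubeOps39` over `bg9YR … R₁ R₂ x` with block map `blk39F … (bI x)` and
operator letter the GENUINE `L39 x.toKIdx (𝔏 x).parS (𝔏 x).Gp` (the two typings p547421 introduced separately, combined).
[cite: Balaban1985BackgroundPropagators, (3.87) p.409 + (3.95) p.411 + Thm 3.2 p.398; Balaban1984PropagatorsII, (2.45) p.231 + p.248 (degenerate reading; faithful representatives)] -/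
def oneCubeOps39YFR (x : MemberY θ.d₆ θ.ℓ₆ θ.hd' θ.hL' θ.b₀ θ.b₁ Mstar) :
    Ops39Blk (geo9Y x) (bg9YR (Matrix (Fin N) (Fin N) ℂ) (specialUnitaryUnits (Fin N)) R₁ R₂ x) (X39 (Matrix (Fin N) (Fin N) ℂ) x.toKIdx)
      Unit Unit :=
  oneCubeOps39 (geo9Y x) (bg9YR (Matrix (Fin N) (Fin N) ℂ) (specialUnitaryUnits (Fin N)) R₁ R₂ x)
    (blk39F (Matrix (Fin N) (Fin N) ℂ) x.toKIdx (bI x)) (L39 x.toKIdx (𝔏 x).parS (𝔏 x).Gp)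

/-- ★ **THE DISPLAY IS GAUGE-ORBIT STABLE IN THE CLASS-PARAMETRIC TYPING** (any `(R₁, R₂)`, any letters family lawful ∕ covariant at the member):
`Conv348Blk (oneCubeOps39YFR … x) B₁ δ₁ U → Conv348Blk (oneCubeOps39YFR … x) (c_R²·B₁) δ₁ U^u` for `SU(N)`-valued `u` — n06-j's
`conv348_oneCubeYF_gaugeY` read at `bg9YR` (same configurations, same `.L`, same `.blk`).  USE: whoever proves the display `h348` of
`t39_hksum_oneCube_opsYOfLetters_FR` on a class may do so on any set of GAUGE REPRESENTATIVES of the class (e.g. the small-field gauge of (3.35)) and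
saturate. [cite: Balaban1985BackgroundPropagators, (3.33) p.396 + (3.35) p.396 («in a gauge») + Thm 3.2 (3.48) p.398; Balaban1984PropagatorsII, (2.51)–(2.52) p.232] -/
theorem conv348_oneCubeYFR_gaugeY (x : MemberY θ.d₆ θ.ℓ₆ θ.hd' θ.hL' θ.b₀ θ.b₁ Mstar)
    (hS : IsGaugeLawS x.toKIdx (𝔏 x).parS) (hGp : IsCovSiteOpY x.toKIdx (𝔏 x).Gp)
    (u : GaugeY (Matrix (Fin N) (Fin N) ℂ) x.toKIdx) (hu : ∀ y, u y ∈ specialUnitaryUnits (Fin N))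
    {B₁ δ₁ : ℝ} (hB₁ : 0 ≤ B₁) {U : CfgY (Matrix (Fin N) (Fin N) ℂ) x.toKIdx}
    (h : Conv348Blk (oneCubeOps39YFR θ Mstar 𝔏 R₁ R₂ bI x) B₁ δ₁ U) :
    Conv348Blk (oneCubeOps39YFR θ Mstar 𝔏 R₁ R₂ bI x) (cR39 (basis39 (Matrix (Fin N) (Fin N) ℂ)) ^ 2 * B₁) δ₁ (gaugeY x.toKIdx u U) := by
  obtain ⟨T, h1, h2, h3⟩ := h
  obtain ⟨T', h1', h2', h3'⟩ := conv348_oneCubeYF_gaugeY θ Mstar 𝔏 bI x hS hGp u hu hB₁ (U := U) ⟨T, h1, h2, h3⟩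
  exact ⟨T', h1', h2', h3'⟩

omit [∀ x : MemberY θ.d₆ θ.ℓ₆ θ.hd' θ.hL' θ.b₀ θ.b₁ Mstar, Fintype (geo9Y x).Site] in
/-- **THE CARRIER-KERNEL READING FOR THE FAITHFUL PINS, CLASS-PARAMETRIC TYPING**: n06-i's `reading_le_of_letters_F` read through the fieldwise re-typing
of Theorem-3.9 letters over `bg9YR … R₁ R₂ x` (same configurations; the re-typed kernel `siteKernelR` has the same entries).
[cite: Balaban1985BackgroundPropagators, Thm 3.2 (3.48) p.398 + (3.96) p.411; Balaban1984PropagatorsII, (2.51) p.232 + p.248] -/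
theorem kerReadsLeVia_opsYOfLettersR_F {ι κ : MemberY θ.d₆ θ.ℓ₆ θ.hd' θ.hL' θ.b₀ θ.b₁ Mstar → Type}
    (hC : ∀ x : MemberY θ.d₆ θ.ℓ₆ θ.hd' θ.hL' θ.b₀ θ.b₁ Mstar, (𝔏 x).C = CY x.toKIdx (𝔏 x).parS (𝔏 x).Gp)
    (𝔬39 : ∀ x : MemberY θ.d₆ θ.ℓ₆ θ.hd' θ.hL' θ.b₀ θ.b₁ Mstar,
      Ops39Blk (geo9Y x) (bg9YR (Matrix (Fin N) (Fin N) ℂ) (specialUnitaryUnits (Fin N)) R₁ R₂ x) (X39 (Matrix (Fin N) (Fin N) ℂ) x.toKIdx)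
        (ι x) (κ x))
    (hblk : ∀ x, (𝔬39 x).blk = blk39F (Matrix (Fin N) (Fin N) ℂ) x.toKIdx (bI x))
    (hL : ∀ x, (𝔬39 x).L = L39 x.toKIdx (𝔏 x).parS (𝔏 x).Gp) (x : MemberY θ.d₆ θ.ℓ₆ θ.hd' θ.hL' θ.b₀ θ.b₁ Mstar) :
    KerReadsLeVia (𝔬39 x) (siteKernelR R₁ R₂ ((opsYOfLetters N θ Mstar 𝔏 𝔈) x).Cinv) (θ.d₆ + 1)
      (cR39 (basis39 (Matrix (Fin N) (Fin N) ℂ)) * Fintype.card (κ39 (Matrix (Fin N) (Fin N) ℂ))) (repSite39F x.toKIdx (bI x)) :=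
  fun U T hTL hLT y y' =>
    reading_le_of_letters_F x (𝔏 x) (𝔈 x) (hC x)
      ⟨(𝔬39 x).blk, (𝔬39 x).S, (𝔬39 x).h, (𝔬39 x).chi, (𝔬39 x).L, (𝔬39 x).Lloc, (𝔬39 x).Cl, (𝔬39 x).Sw, (𝔬39 x).Rw⟩
      (hblk x) (hL x) U T hTL hLT y y'

/-- ★ **ROWS 15 ∧ 16 AT GENERIC `(R₁, R₂)` FROM ONE DISPLAY ON THE FAITHFUL BLOCK MAP** — the CASCADE-R × faithful twin of p547421's
`t39_hksum_oneCube_opsYOfLetters(R∕_F)` over n06-j's generic route `thm39_and_kernelSum_of_pin_rowConst261BlkViaDatum` (representatives `repSite39F`,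
their invariances `len_repSite39F` ∕ `dist_repSite39F_left` ∕ `_right` from n06-i's binder `hβI`): from the display `h348` («for members above `M₁`, `α₀ ∈
(0, a₁∕(c35Y·M)]`, `U ∈ R₁`: `L39(U)` has a two-sided inverse with block majorant `B₀(Lʲη)⁻⁴e^{−δ₀d}` w.r.t. `blk39F (bI x)`»), the letter coherence `hC` and
the `𝔈`-pin `hEK39`, the two leaves `B9.Thm39Printed … (bg9YR … R₁ R₂) (fun x => rwKernelExpansionR R₁ R₂ (ops x).EK39)` ∧ `B9.RWKernelSumYields …`.
[cite: Balaban1985BackgroundPropagators, Thm 3.9 (3.98)–(3.99) p.413 + Thm 3.2 (3.48) p.398 + (3.96) p.411; Balaban1984PropagatorsII, (2.51) p.232 + Lemma 2.1 (2.61) p.234 + p.248] -/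
theorem t39_hksum_oneCube_opsYOfLetters_FR (α' r B₀ δ₀ a₁ M₁ : ℝ)
    (hα'0 : 0 < α') (hα'1 : α' < 1) (hr : 0 < r) (hrδ : r ≤ δ₀) (hB₀ : 0 < B₀) (ha₁ : 0 < a₁) (hM₁ : 0 < M₁)
    (h348 : ∀ x : MemberY θ.d₆ θ.ℓ₆ θ.hd' θ.hL' θ.b₀ θ.b₁ Mstar, M₁ ≤ (geo9Y x).M → ∀ α₀ : ℝ, 0 < α₀ → c35Y * (geo9Y x).M * α₀ ≤ a₁ →
      ∀ U : (bg9YR (Matrix (Fin N) (Fin N) ℂ) (specialUnitaryUnits (Fin N)) R₁ R₂ x).Cfg,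
        (bg9YR (Matrix (Fin N) (Fin N) ℂ) (specialUnitaryUnits (Fin N)) R₁ R₂ x).Reg335 c35Y α₀ U →
          Conv348Blk (oneCubeOps39YFR θ Mstar 𝔏 R₁ R₂ bI x) B₀ δ₀ U)
    (hC : ∀ x : MemberY θ.d₆ θ.ℓ₆ θ.hd' θ.hL' θ.b₀ θ.b₁ Mstar, (𝔏 x).C = CY x.toKIdx (𝔏 x).parS (𝔏 x).Gp)
    (hβI : ∀ (x : MemberY θ.d₆ θ.ℓ₆ θ.hd' θ.hL' θ.b₀ θ.b₁ Mstar) (f : FBondY x.toKIdx) (c : IBondY x.toKIdx),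
      blkV1 x.hN x.D f = β x.hN x.D x.hk c → β x.hN x.D x.hk (bI x f) = blkV1 x.hN x.D f)
    (hEK39 : ∀ x : MemberY θ.d₆ θ.ℓ₆ θ.hd' θ.hL' θ.b₀ θ.b₁ Mstar,
      rwKernelExpansionR R₁ R₂ ((opsYOfLetters N θ Mstar 𝔏 𝔈) x).EK39 =
      EK39OfOpsBlkVia (oneCubeOps39YFR θ Mstar 𝔏 R₁ R₂ bI x) (oneCubeReading39 _) (θ.d₆ + 1)
        (2 * (1 * B₀) * B9RowSum261DefiniteFaces.rowConst261 (geo9Y (d := θ.d₆) (ℓ := θ.ℓ₆) (hd := θ.hd') (hL := θ.hL')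
          (b₀ := θ.b₀) (b₁ := θ.b₁) (Mstar := Mstar)) (α' * r)) ((1 - α') * r) (repSite39F x.toKIdx (bI x))) :
    B9.Thm39Printed (θ.d₆ + 1) c35Y geo9Y (bg9YR (Matrix (Fin N) (Fin N) ℂ) (specialUnitaryUnits (Fin N)) R₁ R₂)
        (fun x => rwKernelExpansionR R₁ R₂ ((opsYOfLetters N θ Mstar 𝔏 𝔈) x).EK39) ∧
      B9.RWKernelSumYields (θ.d₆ + 1) geo9Y (bg9YR (Matrix (Fin N) (Fin N) ℂ) (specialUnitaryUnits (Fin N)) R₁ R₂)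
        (fun x => rwKernelExpansionR R₁ R₂ ((opsYOfLetters N θ Mstar 𝔏 𝔈) x).EK39)
        (fun x => siteKernelR R₁ R₂ ((opsYOfLetters N θ Mstar 𝔏 𝔈) x).Cinv) :=
  thm39_and_kernelSum_of_pin_rowConst261BlkViaDatum (fun x => oneCubeOps39YFR θ Mstar 𝔏 R₁ R₂ bI x) (fun _ => oneCubeReading39 _)
    (fun x => siteKernelR R₁ R₂ ((opsYOfLetters N θ Mstar 𝔏 𝔈) x).Cinv) (θ.d₆ + 1) (fun x => repSite39F x.toKIdx (bI x))
    (1 / 2) α' r δ₀ 0 B₀ 1 a₁ M₁ (cR39 (basis39 (Matrix (Fin N) (Fin N) ℂ)) * Fintype.card (κ39 (Matrix (Fin N) (Fin N) ℂ))) c35Y_pos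
    one_half_pos one_half_lt_one hα'0 hα'1 hr hrδ le_rfl hB₀ zero_le_one ha₁ hM₁ (mul_nonneg (cR39_nonneg _) (Nat.cast_nonneg _))
    (fun x => staticOK39Blk_oneCube _ _ (geo9Y_dist_triangle x) (geo9Y_dist_self x) (geo9K_dist_nonneg' x.toKIdx) (geo9Y_len_pos x))
    (fun _ => locality39Blk_oneCube _ _) rowSum261_geo9Y (fun x y => len_repSite39F (hβI x) y)
    (fun x y z => dist_repSite39F_left (hβI x) y z) (fun x z y => dist_repSite39F_right (hβI x) z y)
    (kerReadsLeVia_opsYOfLettersR_F θ Mstar 𝔏 𝔈 R₁ R₂ bI hC (fun x => oneCubeOps39YFR θ Mstar 𝔏 R₁ R₂ bI x) (fun _ => rfl) (fun _ => rfl))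
    (fun x hM α₀ hα ha U hU => schemas39_oneCube_of_conv348 _ _ r le_rfl (geo9Y_M_nonneg θ Mstar x) (h348 x hM α₀ hα ha U hU)) hEK39

end FaceFR

/-! ## §2 On the class of pure gauges at the letters of record: the display discharged, rows 15 ∧ 16 from the pins, and with the pin built in -/

section PureGauge

open scoped Matrix.Norms.L2Operator

variable {N : ℕ} (θ : Stage3Params) (Mstar : ℕ)
variable [∀ x : MemberY θ.d₆ θ.ℓ₆ θ.hd' θ.hL' θ.b₀ θ.b₁ Mstar, Fintype (geo9Y x).Site]
  [∀ x : MemberY θ.d₆ θ.ℓ₆ θ.hd' θ.hL' θ.b₀ θ.b₁ Mstar, DecidableEq (geo9Y x).Site]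

/-- ★ **THE ONE DISPLAY OF ROWS 15–16 DISCHARGED ON THE PURE-GAUGE CLASS AT THE RECORD**: there are `M₁, B₀, δ₀ > 0` such that for every residual
letter `𝔯`, every second class `R₂`, every level-∕1-faithful bond map, every member with `M₁ ≦ M`, every `α₀` and every `U` in `pureGaugeFamY` at the
member: `Conv348Blk (oneCubeOps39YFR θ M⋆ (lettersYOfRecordV4 N θ M⋆ 𝔯) pureGaugeFamY R₂ bI x) B₀ δ₀ U` — `conv348_oneCubeYF_pureGauge_recordV4`
read at the class-parametric typing (same configurations, same `.L`, same `.blk`).  The `h348` binder of `t39_hksum_oneCube_opsYOfLetters_FR` at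
`R₁ := pureGaugeFamY`, INHABITED for every α₀-guard `a₁`. [cite: Balaban1985BackgroundPropagators, Thm 3.2 (3.48) p.398 + (3.33)–(3.34) p.396 + Cor. 3.5 p.407; Balaban1984PropagatorsII, Prop. 2.3 (2.86)–(2.87) p.238] -/
theorem h348_pureGaugeFamY_F : ∃ M₁ B₀ δ₀ : ℝ, 0 < M₁ ∧ 0 < B₀ ∧ 0 < δ₀ ∧
    ∀ (𝔯 : ResY N θ Mstar) (R₂ : RegFamY θ.d₆ θ.ℓ₆ θ.hd' θ.hL' θ.b₀ θ.b₁ Mstar (Matrix (Fin N) (Fin N) ℂ))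
      (bI : ∀ x : MemberY θ.d₆ θ.ℓ₆ θ.hd' θ.hL' θ.b₀ θ.b₁ Mstar, FBondY x.toKIdx → IBondY x.toKIdx)
      (_hβ1 : ∀ (x : MemberY θ.d₆ θ.ℓ₆ θ.hd' θ.hL' θ.b₀ θ.b₁ Mstar) (f : FBondY x.toKIdx),
        (geomT x.D).dist (β x.hN x.D x.hk (bI x f)) (blkV1 x.hN x.D f) ≤ 1)
      (_hlev : ∀ (x : MemberY θ.d₆ θ.ℓ₆ θ.hd' θ.hL' θ.b₀ θ.b₁ Mstar) (f : FBondY x.toKIdx), lvl x.hN x.D x.hk (bI x f) = (blkV1 x.hN x.D f).1.1)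
      (a₁ : ℝ) (x : MemberY θ.d₆ θ.ℓ₆ θ.hd' θ.hL' θ.b₀ θ.b₁ Mstar), M₁ ≤ (geo9Y x).M → ∀ α₀ : ℝ, 0 < α₀ → c35Y * (geo9Y x).M * α₀ ≤ a₁ →
      ∀ U : (bg9YR (Matrix (Fin N) (Fin N) ℂ) (specialUnitaryUnits (Fin N))
          (pureGaugeFamY (Matrix (Fin N) (Fin N) ℂ) (specialUnitaryUnits (Fin N))) R₂ x).Cfg,
        (bg9YR (Matrix (Fin N) (Fin N) ℂ) (specialUnitaryUnits (Fin N))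
          (pureGaugeFamY (Matrix (Fin N) (Fin N) ℂ) (specialUnitaryUnits (Fin N))) R₂ x).Reg335 c35Y α₀ U →
          Conv348Blk (oneCubeOps39YFR θ Mstar (lettersYOfRecordV4 N θ Mstar 𝔯)
            (pureGaugeFamY (Matrix (Fin N) (Fin N) ℂ) (specialUnitaryUnits (Fin N))) R₂ bI x) B₀ δ₀ U := by
  obtain ⟨M₁, B₀, δ₀, hM₁, hB₀, hδ₀, h⟩ := conv348_oneCubeYF_pureGauge_recordV4 (N := N) θ Mstar
  refine ⟨M₁, B₀, δ₀, hM₁, hB₀, hδ₀, ?_⟩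
  rintro 𝔯 R₂ bI hβ1 hlev a₁ x hM α₀ - - U ⟨u, hu, rfl⟩
  obtain ⟨T, h1, h2, h3⟩ := h 𝔯 bI hβ1 hlev x hM u hu
  exact ⟨T, h1, h2, h3⟩

variable (𝔯 : ResY N θ Mstar) (𝔈 : ExpsY N θ Mstar)
variable (R₂ : RegFamY θ.d₆ θ.ℓ₆ θ.hd' θ.hL' θ.b₀ θ.b₁ Mstar (Matrix (Fin N) (Fin N) ℂ))
variable (bI : ∀ x : MemberY θ.d₆ θ.ℓ₆ θ.hd' θ.hL' θ.b₀ θ.b₁ Mstar, FBondY x.toKIdx → IBondY x.toKIdx)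

/-- ★★ **ROWS 15 ∧ 16 ON THE PURE-GAUGE CLASS FROM THE PINS ALONE**: there are `M₁, B₀, δ₀ > 0` such that for every `𝔯`, every expansion record `𝔈`,
every `R₂`, every faithful bond map `bI` (`hβI`, `hβ1`, `hlev` — n06-i's geometric binders), all rates `0 < α′ < 1`, `0 < r ≦ δ₀`, IF `𝔈` is pinned
to the one-cube datum on the faithful block map at `(B₀, α′, r)` (`hEK39`), THEN the two leaves of rows 15 ∧ 16 hold at `R₁ := pureGaugeFamY`:
`B9.Thm39Printed … ∧ B9.RWKernelSumYields …` at `ops := opsYOfLetters N θ M⋆ (lettersYOfRecordV4 N θ M⋆ 𝔯) 𝔈` — `t39_hksum_oneCube_opsYOfLetters_FR`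
with `h348 := h348_pureGaugeFamY_F` and `hC := rfl`.  NO analytic hypothesis. [cite: Balaban1985BackgroundPropagators, Thm 3.9 (3.98)–(3.99) p.413 + Thm 3.2 (3.48) p.398 + (3.33)–(3.34) p.396 + Cor. 3.5 p.407; Balaban1984PropagatorsII, Prop. 2.3 (2.86)–(2.87) p.238 + Lemma 2.1 (2.61) p.234] -/
theorem t39_hksum_pureGaugeR : ∃ M₁ B₀ δ₀ : ℝ, 0 < M₁ ∧ 0 < B₀ ∧ 0 < δ₀ ∧
    ∀ (𝔯 : ResY N θ Mstar) (𝔈 : ExpsY N θ Mstar) (R₂ : RegFamY θ.d₆ θ.ℓ₆ θ.hd' θ.hL' θ.b₀ θ.b₁ Mstar (Matrix (Fin N) (Fin N) ℂ))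
      (bI : ∀ x : MemberY θ.d₆ θ.ℓ₆ θ.hd' θ.hL' θ.b₀ θ.b₁ Mstar, FBondY x.toKIdx → IBondY x.toKIdx)
      (_hβI : ∀ (x : MemberY θ.d₆ θ.ℓ₆ θ.hd' θ.hL' θ.b₀ θ.b₁ Mstar) (f : FBondY x.toKIdx) (c : IBondY x.toKIdx),
        blkV1 x.hN x.D f = β x.hN x.D x.hk c → β x.hN x.D x.hk (bI x f) = blkV1 x.hN x.D f)
      (_hβ1 : ∀ (x : MemberY θ.d₆ θ.ℓ₆ θ.hd' θ.hL' θ.b₀ θ.b₁ Mstar) (f : FBondY x.toKIdx),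
        (geomT x.D).dist (β x.hN x.D x.hk (bI x f)) (blkV1 x.hN x.D f) ≤ 1)
      (_hlev : ∀ (x : MemberY θ.d₆ θ.ℓ₆ θ.hd' θ.hL' θ.b₀ θ.b₁ Mstar) (f : FBondY x.toKIdx), lvl x.hN x.D x.hk (bI x f) = (blkV1 x.hN x.D f).1.1)
      (α' r : ℝ) (_hα'0 : 0 < α') (_hα'1 : α' < 1) (_hr : 0 < r) (_hrδ : r ≤ δ₀)
      (_hEK39 : ∀ x : MemberY θ.d₆ θ.ℓ₆ θ.hd' θ.hL' θ.b₀ θ.b₁ Mstar,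
        rwKernelExpansionR (pureGaugeFamY (Matrix (Fin N) (Fin N) ℂ) (specialUnitaryUnits (Fin N))) R₂
            ((opsYOfLetters N θ Mstar (lettersYOfRecordV4 N θ Mstar 𝔯) 𝔈) x).EK39 =
          EK39OfOpsBlkVia (oneCubeOps39YFR θ Mstar (lettersYOfRecordV4 N θ Mstar 𝔯)
              (pureGaugeFamY (Matrix (Fin N) (Fin N) ℂ) (specialUnitaryUnits (Fin N))) R₂ bI x) (oneCubeReading39 _) (θ.d₆ + 1)
            (2 * (1 * B₀) * B9RowSum261DefiniteFaces.rowConst261 (geo9Y (d := θ.d₆) (ℓ := θ.ℓ₆) (hd := θ.hd') (hL := θ.hL')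
              (b₀ := θ.b₀) (b₁ := θ.b₁) (Mstar := Mstar)) (α' * r)) ((1 - α') * r) (repSite39F x.toKIdx (bI x))),
      B9.Thm39Printed (θ.d₆ + 1) c35Y geo9Y
          (bg9YR (Matrix (Fin N) (Fin N) ℂ) (specialUnitaryUnits (Fin N))
            (pureGaugeFamY (Matrix (Fin N) (Fin N) ℂ) (specialUnitaryUnits (Fin N))) R₂)
          (fun x => rwKernelExpansionR (pureGaugeFamY (Matrix (Fin N) (Fin N) ℂ) (specialUnitaryUnits (Fin N))) R₂
            ((opsYOfLetters N θ Mstar (lettersYOfRecordV4 N θ Mstar 𝔯) 𝔈) x).EK39) ∧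
        B9.RWKernelSumYields (θ.d₆ + 1) geo9Y
          (bg9YR (Matrix (Fin N) (Fin N) ℂ) (specialUnitaryUnits (Fin N))
            (pureGaugeFamY (Matrix (Fin N) (Fin N) ℂ) (specialUnitaryUnits (Fin N))) R₂)
          (fun x => rwKernelExpansionR (pureGaugeFamY (Matrix (Fin N) (Fin N) ℂ) (specialUnitaryUnits (Fin N))) R₂
            ((opsYOfLetters N θ Mstar (lettersYOfRecordV4 N θ Mstar 𝔯) 𝔈) x).EK39)
          (fun x => siteKernelR (pureGaugeFamY (Matrix (Fin N) (Fin N) ℂ) (specialUnitaryUnits (Fin N))) R₂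
            ((opsYOfLetters N θ Mstar (lettersYOfRecordV4 N θ Mstar 𝔯) 𝔈) x).Cinv) := by
  obtain ⟨M₁, B₀, δ₀, hM₁, hB₀, hδ₀, h⟩ := h348_pureGaugeFamY_F (N := N) θ Mstar
  refine ⟨M₁, B₀, δ₀, hM₁, hB₀, hδ₀, fun 𝔯 𝔈 R₂ bI hβI hβ1 hlev α' r hα'0 hα'1 hr hrδ hEK39 => ?_⟩
  exact t39_hksum_oneCube_opsYOfLetters_FR θ Mstar (lettersYOfRecordV4 N θ Mstar 𝔯) 𝔈
    (pureGaugeFamY (Matrix (Fin N) (Fin N) ℂ) (specialUnitaryUnits (Fin N))) R₂ bI α' r B₀ δ₀ 1 M₁ hα'0 hα'1 hr hrδ hB₀ one_pos hM₁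
    (h 𝔯 R₂ bI hβ1 hlev 1) (fun _ => rfl) hβI hEK39

/-- **THE EXPANSION LETTERS WITH THE THEOREM-3.9 KERNEL EXPANSION PINNED** to the one-cube datum on the faithful block map at the letters of record
(constants `(B₀, α′, r)`): `𝔈` with its free field `EK39` replaced by `EK39OfOpsBlkVia (oneCubeOps39YF θ M⋆ (lettersYOfRecordV4 …) bI x) oneCubeReading39
(d+1) (2·B₀·rowConst261 geo9Y (α′r)) ((1−α′)r) (repSite39F x.toKIdx (bI x))` — the datum at which the `𝔈`-pin `hEK39` holds by `rfl` (in every typing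
`bg9YR R₁ R₂`). [cite: Balaban1985BackgroundPropagators, Thm 3.9 (3.98)–(3.99) p.413 (the kernel expansion as a datum)] -/
def pinEK39F (B₀ α' r : ℝ) : ExpsY N θ Mstar := fun x =>
  { 𝔈 x with
    EK39 := EK39OfOpsBlkVia (oneCubeOps39YF θ Mstar (lettersYOfRecordV4 N θ Mstar 𝔯) bI x) (oneCubeReading39 _) (θ.d₆ + 1)
      (2 * (1 * B₀) * B9RowSum261DefiniteFaces.rowConst261 (geo9Y (d := θ.d₆) (ℓ := θ.ℓ₆) (hd := θ.hd') (hL := θ.hL')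
        (b₀ := θ.b₀) (b₁ := θ.b₁) (Mstar := Mstar)) (α' * r)) ((1 - α') * r) (repSite39F x.toKIdx (bI x)) }

/-- at the pinned letters the `𝔈`-pin `hEK39` of the class-parametric faces holds by `rfl`, for EVERY typing `(R₁, R₂)` (same configurations, same
letters, same reading). [cite: Balaban1985BackgroundPropagators, Thm 3.9 (3.98)–(3.99) p.413, bookkeeping] -/
theorem EK39_pinEK39F (B₀ α' r : ℝ) (R₁ : RegFamY θ.d₆ θ.ℓ₆ θ.hd' θ.hL' θ.b₀ θ.b₁ Mstar (Matrix (Fin N) (Fin N) ℂ))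
    (x : MemberY θ.d₆ θ.ℓ₆ θ.hd' θ.hL' θ.b₀ θ.b₁ Mstar) :
    rwKernelExpansionR R₁ R₂ ((opsYOfLetters N θ Mstar (lettersYOfRecordV4 N θ Mstar 𝔯) (pinEK39F θ Mstar 𝔯 𝔈 bI B₀ α' r)) x).EK39 =
      EK39OfOpsBlkVia (oneCubeOps39YFR θ Mstar (lettersYOfRecordV4 N θ Mstar 𝔯) R₁ R₂ bI x) (oneCubeReading39 _) (θ.d₆ + 1)
        (2 * (1 * B₀) * B9RowSum261DefiniteFaces.rowConst261 (geo9Y (d := θ.d₆) (ℓ := θ.ℓ₆) (hd := θ.hd') (hL := θ.hL')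
          (b₀ := θ.b₀) (b₁ := θ.b₁) (Mstar := Mstar)) (α' * r)) ((1 - α') * r) (repSite39F x.toKIdx (bI x)) :=
  rfl

/-- ★★★ **ROWS 15 ∧ 16 ON THE PURE-GAUGE CLASS WITH THE PIN BUILT IN — NO ANALYTIC HYPOTHESIS**: there are `M₁, B₀, δ₀ > 0` such that for every
residual letter `𝔯`, every expansion record `𝔈`, every `R₂`, every faithful bond map (`hβI`, `hβ1`, `hlev`) and all rates `0 < α′ < 1`, `0 < r ≦ δ₀`, at
`ops := opsYOfLetters N θ M⋆ (lettersYOfRecordV4 N θ M⋆ 𝔯) (pinEK39F θ M⋆ 𝔯 𝔈 bI B₀ α′ r)` the two leaves of rows 15 ∧ 16 HOLD on `R₁ := pureGaugeFamY`: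
for every member above `M₁`, every `α₀ ∈ (0, a₀∕M]` and every pure gauge `U = 1^u` the Theorem-3.9 kernel expansion of `(Q′G′²Q′*)⁻¹(U)` read at
def-Y's genuine letters converges with the printed locality and bounds, and its kernel sums to `(ops x).Cinv` — print's «for U = 1 … proved in [4]» +
(3.33), at the record, in kernel form. [cite: Balaban1985BackgroundPropagators, Thm 3.9 (3.98)–(3.99) p.413 + Thm 3.2 (3.48) p.398 + (3.33)–(3.34) p.396 + Cor. 3.5 p.407; Balaban1984PropagatorsII, Prop. 2.3 (2.86)–(2.87) p.238 + Lemma 2.1 (2.61) p.234] -/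
theorem t39_hksum_pureGaugeR_pinned : ∃ M₁ B₀ δ₀ : ℝ, 0 < M₁ ∧ 0 < B₀ ∧ 0 < δ₀ ∧
    ∀ (𝔯 : ResY N θ Mstar) (𝔈 : ExpsY N θ Mstar) (R₂ : RegFamY θ.d₆ θ.ℓ₆ θ.hd' θ.hL' θ.b₀ θ.b₁ Mstar (Matrix (Fin N) (Fin N) ℂ))
      (bI : ∀ x : MemberY θ.d₆ θ.ℓ₆ θ.hd' θ.hL' θ.b₀ θ.b₁ Mstar, FBondY x.toKIdx → IBondY x.toKIdx)
      (_hβI : ∀ (x : MemberY θ.d₆ θ.ℓ₆ θ.hd' θ.hL' θ.b₀ θ.b₁ Mstar) (f : FBondY x.toKIdx) (c : IBondY x.toKIdx),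
        blkV1 x.hN x.D f = β x.hN x.D x.hk c → β x.hN x.D x.hk (bI x f) = blkV1 x.hN x.D f)
      (_hβ1 : ∀ (x : MemberY θ.d₆ θ.ℓ₆ θ.hd' θ.hL' θ.b₀ θ.b₁ Mstar) (f : FBondY x.toKIdx),
        (geomT x.D).dist (β x.hN x.D x.hk (bI x f)) (blkV1 x.hN x.D f) ≤ 1)
      (_hlev : ∀ (x : MemberY θ.d₆ θ.ℓ₆ θ.hd' θ.hL' θ.b₀ θ.b₁ Mstar) (f : FBondY x.toKIdx), lvl x.hN x.D x.hk (bI x f) = (blkV1 x.hN x.D f).1.1)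
      (α' r : ℝ) (_hα'0 : 0 < α') (_hα'1 : α' < 1) (_hr : 0 < r) (_hrδ : r ≤ δ₀),
      B9.Thm39Printed (θ.d₆ + 1) c35Y geo9Y
          (bg9YR (Matrix (Fin N) (Fin N) ℂ) (specialUnitaryUnits (Fin N))
            (pureGaugeFamY (Matrix (Fin N) (Fin N) ℂ) (specialUnitaryUnits (Fin N))) R₂)
          (fun x => rwKernelExpansionR (pureGaugeFamY (Matrix (Fin N) (Fin N) ℂ) (specialUnitaryUnits (Fin N))) R₂
            ((opsYOfLetters N θ Mstar (lettersYOfRecordV4 N θ Mstar 𝔯) (pinEK39F θ Mstar 𝔯 𝔈 bI B₀ α' r)) x).EK39) ∧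
        B9.RWKernelSumYields (θ.d₆ + 1) geo9Y
          (bg9YR (Matrix (Fin N) (Fin N) ℂ) (specialUnitaryUnits (Fin N))
            (pureGaugeFamY (Matrix (Fin N) (Fin N) ℂ) (specialUnitaryUnits (Fin N))) R₂)
          (fun x => rwKernelExpansionR (pureGaugeFamY (Matrix (Fin N) (Fin N) ℂ) (specialUnitaryUnits (Fin N))) R₂
            ((opsYOfLetters N θ Mstar (lettersYOfRecordV4 N θ Mstar 𝔯) (pinEK39F θ Mstar 𝔯 𝔈 bI B₀ α' r)) x).EK39)
          (fun x => siteKernelR (pureGaugeFamY (Matrix (Fin N) (Fin N) ℂ) (specialUnitaryUnits (Fin N))) R₂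
            ((opsYOfLetters N θ Mstar (lettersYOfRecordV4 N θ Mstar 𝔯) (pinEK39F θ Mstar 𝔯 𝔈 bI B₀ α' r)) x).Cinv) := by
  obtain ⟨M₁, B₀, δ₀, hM₁, hB₀, hδ₀, h⟩ := t39_hksum_pureGaugeR (N := N) θ Mstar
  exact ⟨M₁, B₀, δ₀, hM₁, hB₀, hδ₀, fun 𝔯 𝔈 R₂ bI hβI hβ1 hlev α' r hα'0 hα'1 hr hrδ =>
    h 𝔯 (pinEK39F θ Mstar 𝔯 𝔈 bI B₀ α' r) R₂ bI hβI hβ1 hlev α' r hα'0 hα'1 hr hrδ fun _ => rfl⟩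

/-- ★★★ **THEOREM 3.2 AS TYPED BY THE CERTIFICATE, ON THE PURE-GAUGE CLASS, WITH THE PIN BUILT IN**: `B9.Thm32Printed (d+1) c35Y geo9Y (bg9YR …
pureGaugeFamY R₂) (fun x => siteKernelR … (ops x).Cinv)` at the pinned record — by `B9.thm32_of_thm39` (print p. 413 «This theorem implies Theorem 3.2»)
on `t39_hksum_pureGaugeR_pinned`. [cite: Balaban1985BackgroundPropagators, Thm 3.2 (3.48) p.398 + Thm 3.9 p.413 + Cor. 3.5 p.407; Balaban1984PropagatorsII, Prop. 2.3 (2.86)–(2.87) p.238] -/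
theorem thm32_pureGaugeR_pinned : ∃ M₁ B₀ δ₀ : ℝ, 0 < M₁ ∧ 0 < B₀ ∧ 0 < δ₀ ∧
    ∀ (𝔯 : ResY N θ Mstar) (𝔈 : ExpsY N θ Mstar) (R₂ : RegFamY θ.d₆ θ.ℓ₆ θ.hd' θ.hL' θ.b₀ θ.b₁ Mstar (Matrix (Fin N) (Fin N) ℂ))
      (bI : ∀ x : MemberY θ.d₆ θ.ℓ₆ θ.hd' θ.hL' θ.b₀ θ.b₁ Mstar, FBondY x.toKIdx → IBondY x.toKIdx)
      (_hβI : ∀ (x : MemberY θ.d₆ θ.ℓ₆ θ.hd' θ.hL' θ.b₀ θ.b₁ Mstar) (f : FBondY x.toKIdx) (c : IBondY x.toKIdx),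
        blkV1 x.hN x.D f = β x.hN x.D x.hk c → β x.hN x.D x.hk (bI x f) = blkV1 x.hN x.D f)
      (_hβ1 : ∀ (x : MemberY θ.d₆ θ.ℓ₆ θ.hd' θ.hL' θ.b₀ θ.b₁ Mstar) (f : FBondY x.toKIdx),
        (geomT x.D).dist (β x.hN x.D x.hk (bI x f)) (blkV1 x.hN x.D f) ≤ 1)
      (_hlev : ∀ (x : MemberY θ.d₆ θ.ℓ₆ θ.hd' θ.hL' θ.b₀ θ.b₁ Mstar) (f : FBondY x.toKIdx), lvl x.hN x.D x.hk (bI x f) = (blkV1 x.hN x.D f).1.1)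
      (α' r : ℝ) (_hα'0 : 0 < α') (_hα'1 : α' < 1) (_hr : 0 < r) (_hrδ : r ≤ δ₀),
      B9.Thm32Printed (θ.d₆ + 1) c35Y geo9Y
        (bg9YR (Matrix (Fin N) (Fin N) ℂ) (specialUnitaryUnits (Fin N))
          (pureGaugeFamY (Matrix (Fin N) (Fin N) ℂ) (specialUnitaryUnits (Fin N))) R₂)
        (fun x => siteKernelR (pureGaugeFamY (Matrix (Fin N) (Fin N) ℂ) (specialUnitaryUnits (Fin N))) R₂
          ((opsYOfLetters N θ Mstar (lettersYOfRecordV4 N θ Mstar 𝔯) (pinEK39F θ Mstar 𝔯 𝔈 bI B₀ α' r)) x).Cinv) := by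
  obtain ⟨M₁, B₀, δ₀, hM₁, hB₀, hδ₀, h⟩ := t39_hksum_pureGaugeR_pinned (N := N) θ Mstar
  refine ⟨M₁, B₀, δ₀, hM₁, hB₀, hδ₀, fun 𝔯 𝔈 R₂ bI hβI hβ1 hlev α' r hα'0 hα'1 hr hrδ => ?_⟩
  obtain ⟨h39, hks⟩ := h 𝔯 𝔈 R₂ bI hβI hβ1 hlev α' r hα'0 hα'1 hr hrδ
  exact B9.thm32_of_thm39 _ _ _ _ _ _ h39 hks

end PureGauge

/-! ## §3 Rows 15 ∧ 16 ∧ 17 JOINTLY on the pure-gauge class: one class, one letters family, one expansion record, zero analytic hypotheses -/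

section Joint

open scoped Matrix.Norms.L2Operator

variable {N : ℕ} (θ : Stage3Params) (Mstar : ℕ)
variable [∀ x : MemberY θ.d₆ θ.ℓ₆ θ.hd' θ.hL' θ.b₀ θ.b₁ Mstar, Fintype (geo9Y x).Site]
  [∀ x : MemberY θ.d₆ θ.ℓ₆ θ.hd' θ.hL' θ.b₀ θ.b₁ Mstar, DecidableEq (geo9Y x).Site]

/-- ★★★ **ROWS 15 ∧ 16 ∧ 17 OF THE N06 CERTIFICATE HOLD JOINTLY ON THE CLASS OF PURE GAUGES, ZERO ANALYTIC HYPOTHESES**: there are `M₁, B₀, δ₀ > 0`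
such that for every residual letter `𝔯`, every expansion record `𝔈`, every second class `R₂`, every faithful bond map and all admissible rates, at the
ONE class `R₁ := pureGaugeFamY` (non-empty at every member), the ONE letters family `lettersYOfRecordV4 N θ M⋆ 𝔯` and the ONE expansion record
`𝔈⋆ := pinPosDef311 θ M⋆ 𝔯 (pinEK39F θ M⋆ 𝔯 𝔈 bI B₀ α′ r)` (Theorem 3.9's kernel expansion AND Theorem 3.11's positivity letter pinned to the genuine
objects): `Thm39Printed` (row 15) ∧ `RWKernelSumYields` (row 16) ∧ `Thm311Printed` (row 17, g13's `t311_pureGaugeR_pinned`) — the three faces'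
member-local binder families are JOINTLY inhabited, non-vacuously, with the same `θ, M⋆, 𝔯, 𝔈⋆, R₂`. [cite: Balaban1985BackgroundPropagators, Thm 3.9 p.413 + Thm 3.2 (3.48) p.398 + Thm 3.11 p.416 + (3.33)–(3.34) p.396 + Cor. 3.5 p.407; Balaban1984PropagatorsII, Prop. 2.3 (2.86)–(2.87) p.238 + p.228] -/
theorem rows151617_pureGaugeR_pinned : ∃ M₁ B₀ δ₀ : ℝ, 0 < M₁ ∧ 0 < B₀ ∧ 0 < δ₀ ∧
    ∀ (𝔯 : ResY N θ Mstar) (𝔈 : ExpsY N θ Mstar) (R₂ : RegFamY θ.d₆ θ.ℓ₆ θ.hd' θ.hL' θ.b₀ θ.b₁ Mstar (Matrix (Fin N) (Fin N) ℂ))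
      (bI : ∀ x : MemberY θ.d₆ θ.ℓ₆ θ.hd' θ.hL' θ.b₀ θ.b₁ Mstar, FBondY x.toKIdx → IBondY x.toKIdx)
      (_hβI : ∀ (x : MemberY θ.d₆ θ.ℓ₆ θ.hd' θ.hL' θ.b₀ θ.b₁ Mstar) (f : FBondY x.toKIdx) (c : IBondY x.toKIdx),
        blkV1 x.hN x.D f = β x.hN x.D x.hk c → β x.hN x.D x.hk (bI x f) = blkV1 x.hN x.D f)
      (_hβ1 : ∀ (x : MemberY θ.d₆ θ.ℓ₆ θ.hd' θ.hL' θ.b₀ θ.b₁ Mstar) (f : FBondY x.toKIdx),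
        (geomT x.D).dist (β x.hN x.D x.hk (bI x f)) (blkV1 x.hN x.D f) ≤ 1)
      (_hlev : ∀ (x : MemberY θ.d₆ θ.ℓ₆ θ.hd' θ.hL' θ.b₀ θ.b₁ Mstar) (f : FBondY x.toKIdx), lvl x.hN x.D x.hk (bI x f) = (blkV1 x.hN x.D f).1.1)
      (α' r : ℝ) (_hα'0 : 0 < α') (_hα'1 : α' < 1) (_hr : 0 < r) (_hrδ : r ≤ δ₀),
      B9.Thm39Printed (θ.d₆ + 1) c35Y geo9Y
          (bg9YR (Matrix (Fin N) (Fin N) ℂ) (specialUnitaryUnits (Fin N))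
            (pureGaugeFamY (Matrix (Fin N) (Fin N) ℂ) (specialUnitaryUnits (Fin N))) R₂)
          (fun x => rwKernelExpansionR (pureGaugeFamY (Matrix (Fin N) (Fin N) ℂ) (specialUnitaryUnits (Fin N))) R₂
            ((opsYOfLetters N θ Mstar (lettersYOfRecordV4 N θ Mstar 𝔯)
              (pinPosDef311 θ Mstar 𝔯 (pinEK39F θ Mstar 𝔯 𝔈 bI B₀ α' r))) x).EK39) ∧
        B9.RWKernelSumYields (θ.d₆ + 1) geo9Y
          (bg9YR (Matrix (Fin N) (Fin N) ℂ) (specialUnitaryUnits (Fin N))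
            (pureGaugeFamY (Matrix (Fin N) (Fin N) ℂ) (specialUnitaryUnits (Fin N))) R₂)
          (fun x => rwKernelExpansionR (pureGaugeFamY (Matrix (Fin N) (Fin N) ℂ) (specialUnitaryUnits (Fin N))) R₂
            ((opsYOfLetters N θ Mstar (lettersYOfRecordV4 N θ Mstar 𝔯)
              (pinPosDef311 θ Mstar 𝔯 (pinEK39F θ Mstar 𝔯 𝔈 bI B₀ α' r))) x).EK39)
          (fun x => siteKernelR (pureGaugeFamY (Matrix (Fin N) (Fin N) ℂ) (specialUnitaryUnits (Fin N))) R₂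
            ((opsYOfLetters N θ Mstar (lettersYOfRecordV4 N θ Mstar 𝔯)
              (pinPosDef311 θ Mstar 𝔯 (pinEK39F θ Mstar 𝔯 𝔈 bI B₀ α' r))) x).Cinv) ∧
        B9.Thm311Printed c35Y geo9Y
          (bg9YR (Matrix (Fin N) (Fin N) ℂ) (specialUnitaryUnits (Fin N))
            (pureGaugeFamY (Matrix (Fin N) (Fin N) ℂ) (specialUnitaryUnits (Fin N))) R₂)
          (fun x => ((opsYOfLetters N θ Mstar (lettersYOfRecordV4 N θ Mstar 𝔯)
            (pinPosDef311 θ Mstar 𝔯 (pinEK39F θ Mstar 𝔯 𝔈 bI B₀ α' r))) x).PosDef) := by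
  obtain ⟨M₁, B₀, δ₀, hM₁, hB₀, hδ₀, h⟩ := t39_hksum_pureGaugeR (N := N) θ Mstar
  refine ⟨M₁, B₀, δ₀, hM₁, hB₀, hδ₀, fun 𝔯 𝔈 R₂ bI hβI hβ1 hlev α' r hα'0 hα'1 hr hrδ => ?_⟩
  obtain ⟨h39, hks⟩ := h 𝔯 (pinPosDef311 θ Mstar 𝔯 (pinEK39F θ Mstar 𝔯 𝔈 bI B₀ α' r)) R₂ bI hβI hβ1 hlev α' r hα'0 hα'1 hr hrδ
    fun _ => rfl
  exact ⟨h39, hks, t311_pureGaugeR_pinned θ Mstar 𝔯 (pinEK39F θ Mstar 𝔯 𝔈 bI B₀ α' r) R₂⟩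

end Joint

/-! ## §4 The binder conjunction of the rows-15–16 face as an `∃`-statement (STANDING A6 RULE, mechanical reading) -/

section A6

open scoped Matrix.Norms.L2Operator

variable {N : ℕ} (θ : Stage3Params) (Mstar : ℕ)
variable [∀ x : MemberY θ.d₆ θ.ℓ₆ θ.hd' θ.hL' θ.b₀ θ.b₁ Mstar, Fintype (geo9Y x).Site]
  [∀ x : MemberY θ.d₆ θ.ℓ₆ θ.hd' θ.hL' θ.b₀ θ.b₁ Mstar, DecidableEq (geo9Y x).Site]

/-- **A6 — THE ANALYTIC BINDER OF `t39_hksum_oneCube_opsYOfLetters_FR` IS INHABITED BY A CLASS NON-EMPTY AT EVERY MEMBER**: `∃ R₁ M₁ B₀ δ₀` with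
«members SU(N)-valued», «`1 ∈ R₁` at every member», `0 < M₁, B₀, δ₀`, and the display `h348` for EVERY `𝔯`, `R₂`, faithful `bI` and every α₀-guard `a₁` —
`R₁ := pureGaugeFamY`; the pins `hC`, `hEK39` are inhabited separately (`rfl` at the record; `EK39_pinEK39F`).
[cite: Balaban1985BackgroundPropagators, Thm 3.2 (3.48) p.398 + (3.33)–(3.34) p.396 + Cor. 3.5 p.407; Balaban1984PropagatorsII, Prop. 2.3 p.238] -/
theorem binders_t39FR_inhabited : ∃ (R₁ : RegFamY θ.d₆ θ.ℓ₆ θ.hd' θ.hL' θ.b₀ θ.b₁ Mstar (Matrix (Fin N) (Fin N) ℂ)) (M₁ B₀ δ₀ : ℝ),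
    MemOfFam (specialUnitaryUnits (Fin N)) R₁ ∧
    (∀ (x : MemberY θ.d₆ θ.ℓ₆ θ.hd' θ.hL' θ.b₀ θ.b₁ Mstar) (c α₀ : ℝ), R₁ x c α₀ (fun _ _ => 1)) ∧
    0 < M₁ ∧ 0 < B₀ ∧ 0 < δ₀ ∧
    ∀ (𝔯 : ResY N θ Mstar) (R₂ : RegFamY θ.d₆ θ.ℓ₆ θ.hd' θ.hL' θ.b₀ θ.b₁ Mstar (Matrix (Fin N) (Fin N) ℂ))
      (bI : ∀ x : MemberY θ.d₆ θ.ℓ₆ θ.hd' θ.hL' θ.b₀ θ.b₁ Mstar, FBondY x.toKIdx → IBondY x.toKIdx)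
      (_hβ1 : ∀ (x : MemberY θ.d₆ θ.ℓ₆ θ.hd' θ.hL' θ.b₀ θ.b₁ Mstar) (f : FBondY x.toKIdx),
        (geomT x.D).dist (β x.hN x.D x.hk (bI x f)) (blkV1 x.hN x.D f) ≤ 1)
      (_hlev : ∀ (x : MemberY θ.d₆ θ.ℓ₆ θ.hd' θ.hL' θ.b₀ θ.b₁ Mstar) (f : FBondY x.toKIdx), lvl x.hN x.D x.hk (bI x f) = (blkV1 x.hN x.D f).1.1)
      (a₁ : ℝ) (x : MemberY θ.d₆ θ.ℓ₆ θ.hd' θ.hL' θ.b₀ θ.b₁ Mstar), M₁ ≤ (geo9Y x).M → ∀ α₀ : ℝ, 0 < α₀ → c35Y * (geo9Y x).M * α₀ ≤ a₁ →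
      ∀ U : (bg9YR (Matrix (Fin N) (Fin N) ℂ) (specialUnitaryUnits (Fin N)) R₁ R₂ x).Cfg,
        (bg9YR (Matrix (Fin N) (Fin N) ℂ) (specialUnitaryUnits (Fin N)) R₁ R₂ x).Reg335 c35Y α₀ U →
          Conv348Blk (oneCubeOps39YFR θ Mstar (lettersYOfRecordV4 N θ Mstar 𝔯) R₁ R₂ bI x) B₀ δ₀ U := by
  obtain ⟨M₁, B₀, δ₀, hM₁, hB₀, hδ₀, h⟩ := h348_pureGaugeFamY_F (N := N) θ Mstar
  exact ⟨pureGaugeFamY (Matrix (Fin N) (Fin N) ℂ) (specialUnitaryUnits (Fin N)), M₁, B₀, δ₀, memOfFam_pureGaugeFamY,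
    fun x c α₀ => one_mem_pureGaugeFamY x c α₀, hM₁, hB₀, hδ₀, h⟩

end A6

end Literature.MathematicalPhysics.QuantumFieldTheory.Balaban1983to89.B9Thm39PureGaugeClassAtLettersR

end
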